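import Summits.Ventures.Crystal3D.Theorems.StickyWulffConstantTextureLiminfTexShadowLevelLedgerDefs
import Summits.Ventures.Crystal3D.Theorems.StickyWulffConstantCoaxialWallLawSaturatedStar
import Summits.Ventures.Crystal3D.Theorems.StickyWulffConstantGenericWallFloorDozenStep
import HarnessLib

/-!
# The level ledger in EVENT currency: first non-full ball of a launched line; injective windowed count; E1 trichotomy
# «pay / glide-read / cross-read» — no twisted event (lane T, crux `TextureLiminfV5`, stmt-Ventures-23912, stub `stub_terraceCensus`; 19480-p1 g19)

HONEST FRAMING. Venture `Summits/Ventures/Crystal3D` (cell `crystal3d-full`), route `route-Ventures-StickyWulffConstant`, helper `--supports` the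
law-v5 crux `TextureLiminfV5` (stmt-Ventures-23912), lane T, line `TexShadow` v8.20, registered stub `stub_terraceCensus : ∃ C, TerraceCensusAt C 10`,
mechanism (β) in the LEDGER architecture (cf-p1 ruling (ccxli); inputs (I2)/(I4)).  Answer to ruling (ccxlviii)(3) «what pays at a located chain end
with a non-close-packed dozen»: NOTHING NEEDS TO — if the ledger's event on a launched line is taken to be the FIRST NON-FULL BALL instead of the located
top end, the event ball is never twisted.  CONDITIONAL on the registered computational fact `P5Exhaustion` (`stub_E1`, E1 row C12-55) BY NAME;
poison-clean import closure (probe `TexShadow.stub_l12Local` compiles on top of this file's imports); pure finite geometry + counting; nothing about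
energies; F-C1 not moved.

THE POINT.  In …TexShadowLevelLedgerDefs (p732417/p732941) the injective count maps a launch ball `b` (with `b + c ∈ X`, no two launch balls on one
`c`-line) to the located TOP END of its chain.  A top end `e` is paid (`≤ 11` contacts) or reads (close-packed dozen) ONLY IF it carries an exact-only
own pattern, and after `stub_E1h` was refuted (p731767) the top of a chain that runs inside a composition plane containing `c` carries only the hcp
in-plane edge star — it may be TWISTED (twelve contacts, not close-packed).  Remedy typed here: walk the line `b, b + c, b + 2c, …` (`c = A δ₀` a slot of
the lamella frame `A`) and stop at the FIRST ball `x` that is NOT FULL in the frame (`¬ IsFull X A x`, lane F's predicate: some slot site `x + A w`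
empty).  Then
* the map launch ↦ event is still INJECTIVE on a launch set and WINDOWED (`zlo ≤ x₂`, and `x₂ ≤ zhi + c₂` unless the predecessor is outside the guard —
  the same blocking as `card_le_card_chainTopEnds_guarded`): **`card_le_card_chainEvents_guarded`**;
* the event ball's predecessor `x − c` IS full, so the closed vertex star of `−δ₀` is occupied around `x` (`star_occupied_of_isFull_pred`) and by
  `P5Exhaustion` + 19481-p1's `shell_slots_or_twin_of_star_twelve` (p732252): **`chainEvent_trichotomy`** — `x` PAYS (`≤ 11` contacts), or its twelve
  contacts are a TWIN dozen of the frame `A` for a menu normal `n` (own nine occupied, every contact an own slot ball or a mirror ball) with EITHER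
  `⟪c, n⟫ = 0` and `x + c ∈ X` (GLIDE-READ: `x` lies on a composition plane containing `c`; the chain goes on, the ledger stops) OR `⟪c, n⟫ = √(2/3)`
  and `x + c ∉ X` (CROSS-READ: `x` is the located top end, a polar read as in …TexShadowReadDirection).  The full alternative of the rigidity lemma
  is excluded by `¬ IsFull`, the value `⟪c, n⟫ = −√(2/3)` because `x − c` is a contact and a slot never coincides with a mirror site
  (`slot_ne_mirrorSite`: the angle would be `arccos(−1/3)`).
So in EVENT currency the answer to (ccxlviii)(3) is «E1, multiplicity one»: no twist unit, no E1h; the price is that glide-reads join the read count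
which (I5) + the pinning (p730052) must bound — they are hcp balls on letter/band planes exactly like cross-reads.
* `star_occupied_of_isFull_pred`, `slot_ne_mirrorSite`, `isFull_of_contacts_subset_slots`;
* `chainEventSteps` / `chainEvent` (the first non-full ball, by `Nat.find`), `chainEvent_mem`, `chainEvent_pred_mem`, `chainEvent_pred_isFull`,
  `not_isFull_chainEvent`, `chainEvent_injOn`;
* **`card_le_card_chainEvents_guarded`**, `card_le_card_chainEvents`;
* **`chainEvent_trichotomy`** (conditional on `P5Exhaustion`).
WHAT THIS IS NOT: the read bound, the launch construction at reads of the previous letter (polar launch keeps the arrival star P₅ — in-plane launch does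
not), or any energy statement; F-C1 not moved.
-/

noncomputable section

open scoped BigOperators InnerProductSpace

namespace Summit.Ventures.Crystal3D.Cruxes.TextureLiminf.TexShadow

open Finset Summit.Ventures.Crystal3D Summit.Ventures.Crystal3D.Theorems
open Literature.Geometry.DiscreteGeometry (fccKissingPattern hcpKissingPattern)

/-! ## The arrival star of a ball whose predecessor is full -/

/-- **The closed vertex star of `−δ₀` is occupied around `x` when the predecessor `x − A δ₀` is full** (all its slot sites occupied) and present:
for every slot `w` with `0 < ⟪w, −δ₀⟫` the site `x + A w` is `x − A δ₀` itself or a slot site `(x − A δ₀) + A (δ₀ + w)` of the predecessor. -/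
theorem star_occupied_of_isFull_pred (A : EuclideanSpace ℝ (Fin 3) ≃ₗᵢ[ℝ] EuclideanSpace ℝ (Fin 3)) {X : Finset (EuclideanSpace ℝ (Fin 3))}
    {x δ₀ : EuclideanSpace ℝ (Fin 3)} (hδ₀ : δ₀ ∈ fccSlots) (hpredX : x - A δ₀ ∈ X) (hpred : IsFull X A (x - A δ₀)) :
    ∀ w ∈ fccSlots, 0 < ⟪w, -δ₀⟫_ℝ → x + A w ∈ X := by
  intro w hw hpos
  have hneg : ⟪w, δ₀⟫_ℝ < 0 := by rw [inner_neg_right] at hpos; linarith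
  rcases eq_neg_or_add_mem_fccSlots_of_inner_neg hδ₀ hw hneg with rfl | hs
  · rw [map_neg, ← sub_eq_add_neg]; exact hpredX
  · have e : x + A w = (x - A δ₀) + A (δ₀ + w) := by rw [map_add]; abel
    rw [e]; exact hpred _ hs

/-- **A slot vector is never a mirror site vector**: for slots `u, w` and a vector `n` with `⟪A w, n⟫ = −√(2/3)`, `A u ≠ A w − 2⟪A w, n⟫ n`
(the inner product `⟪A w − 2⟪A w, n⟫ n, A w⟫ = 1 − 4/3 = −1/3` is not a slot angle). -/
theorem slot_ne_mirrorSite (A : EuclideanSpace ℝ (Fin 3) ≃ₗᵢ[ℝ] EuclideanSpace ℝ (Fin 3)) {n u w : EuclideanSpace ℝ (Fin 3)}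
    (hu : u ∈ fccSlots) (hw : w ∈ fccSlots) (hwn : ⟪A w, n⟫_ℝ = -Real.sqrt (2 / 3)) :
    A u ≠ A w - (2 * ⟪A w, n⟫_ℝ) • n := by
  intro h
  have hww : ⟪A w, A w⟫_ℝ = 1 := by
    rw [real_inner_self_eq_norm_sq, LinearIsometryEquiv.norm_map, norm_eq_one_of_mem_fccSlots hw, one_pow]
  have h23 : Real.sqrt (2 / 3) ^ 2 = 2 / 3 := Real.sq_sqrt (by norm_num)
  have hnw : ⟪n, A w⟫_ℝ = -Real.sqrt (2 / 3) := by rw [real_inner_comm]; exact hwn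
  have hval : ⟪A u, A w⟫_ℝ = -(1 / 3) := by
    rw [h, inner_sub_left, real_inner_smul_left, hww, hnw, hwn]
    linear_combination (-2 : ℝ) * h23
  rw [LinearIsometryEquiv.inner_map_map] at hval
  rcases inner_slots_mem hu hw with h1 | h1 | h1 | h1 | h1 <;> rw [h1] at hval <;> norm_num at hval

/-- **Twelve contacts all at slot sites ⇒ full.**  If every contact of `x` is a slot site `x + A w` and `x` has twelve contacts, then every slot
site is occupied. -/
theorem isFull_of_contacts_subset_slots (A : EuclideanSpace ℝ (Fin 3) ≃ₗᵢ[ℝ] EuclideanSpace ℝ (Fin 3)) {X : Finset (EuclideanSpace ℝ (Fin 3))}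
    {x : EuclideanSpace ℝ (Fin 3)} (hslots : ∀ q ∈ X, dist x q = 1 → ∃ w ∈ fccSlots, q = x + A w)
    (h12 : (X.filter fun q => dist x q = 1).card = 12) : IsFull X A x := by
  classical
  set N := X.filter fun q => dist x q = 1 with hN
  have hsub : N ⊆ fccSlots.image fun w => x + A w := by
    intro q hq
    obtain ⟨hqX, hqd⟩ := mem_filter.1 hq
    obtain ⟨w, hw, rfl⟩ := hslots q hqX hqd
    exact mem_image_of_mem _ hw
  have hcard : (fccSlots.image fun w => x + A w).card ≤ N.card :=
    (card_image_le).trans (by rw [card_fccSlots, h12])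
  have heq : N = fccSlots.image fun w => x + A w := eq_of_subset_of_card_le hsub hcard
  intro w hw
  have : x + A w ∈ N := by rw [heq]; exact mem_image_of_mem _ hw
  exact (mem_filter.1 this).1

/-! ## The event trichotomy under E1 -/

/-- **EVENT TRICHOTOMY.**  `X` `1`-separated, `A` a frame, `δ₀` a slot, `x ∈ X` NOT full whose predecessor `x − A δ₀ ∈ X` IS full.  Under `P5Exhaustion`:
`x` has at most eleven contacts (PAYS), or it has twelve and there is a menu normal `n` of `A` such that the own nine `⟪A w, n⟫ ≤ 0` are occupied,
every contact is an own slot ball or a mirror ball `x + (A w − 2⟪A w, n⟫ n)` (`⟪A w, n⟫ < 0`), and EITHER `⟪A δ₀, n⟫ = 0 ∧ x + A δ₀ ∈ X` (GLIDE-READ)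
OR `⟪A δ₀, n⟫ = √(2/3) ∧ x + A δ₀ ∉ X` (CROSS-READ, `x` is a located top end).  No twisted alternative. -/
theorem chainEvent_trichotomy (hE1 : P5Exhaustion) (A : EuclideanSpace ℝ (Fin 3) ≃ₗᵢ[ℝ] EuclideanSpace ℝ (Fin 3))
    {X : Finset (EuclideanSpace ℝ (Fin 3))} (hX : ∀ p ∈ X, ∀ q ∈ X, p ≠ q → 1 ≤ dist p q)
    {x δ₀ : EuclideanSpace ℝ (Fin 3)} (hδ₀ : δ₀ ∈ fccSlots) (hpredX : x - A δ₀ ∈ X) (hpred : IsFull X A (x - A δ₀))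
    (hnot : ¬ IsFull X A x) :
    (X.filter fun q => dist x q = 1).card ≤ 11 ∨
      ((X.filter fun q => dist x q = 1).card = 12 ∧
        ∃ n : EuclideanSpace ℝ (Fin 3), IsMenuNormal A n ∧
          (∀ w ∈ fccSlots, ⟪A w, n⟫_ℝ ≤ 0 → x + A w ∈ X) ∧
          (∀ q ∈ X, dist x q = 1 →
            (∃ w ∈ fccSlots, ⟪A w, n⟫_ℝ ≤ 0 ∧ q = x + A w) ∨
              ∃ w ∈ fccSlots, ⟪A w, n⟫_ℝ < 0 ∧ q = x + (A w - (2 * ⟪A w, n⟫_ℝ) • n)) ∧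
          ((⟪A δ₀, n⟫_ℝ = 0 ∧ x + A δ₀ ∈ X) ∨ (⟪A δ₀, n⟫_ℝ = Real.sqrt (2 / 3) ∧ x + A δ₀ ∉ X))) := by
  classical
  set N := X.filter fun q => dist x q = 1 with hN
  have hle : N.card ≤ 12 := (isKissingAround_contacts X hX x).card_le_twelve
  rcases Nat.lt_or_ge N.card 12 with hlt | hge
  · exact Or.inl (by omega)
  have h12 : N.card = 12 := le_antisymm hle hge
  right
  refine ⟨h12, ?_⟩
  have hstar := star_occupied_of_isFull_pred A hδ₀ hpredX hpred
  rcases shell_slots_or_twin_of_star_twelve hE1 A hX (neg_mem_fccSlots hδ₀) hstar h12 with hall | ⟨n, hmenu, hown, hcls⟩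
  · exact absurd (isFull_of_contacts_subset_slots A hall h12) hnot
  refine ⟨n, hmenu, hown, hcls, ?_⟩
  have s23 : (0 : ℝ) < Real.sqrt (2 / 3) := Real.sqrt_pos.2 (by norm_num)
  -- slot sites at distance one
  have hslot1 : ∀ {w}, w ∈ fccSlots → dist x (x + A w) = 1 := fun {w} hw => by
    rw [dist_eq_norm, sub_add_cancel_left, norm_neg, LinearIsometryEquiv.norm_map, norm_eq_one_of_mem_fccSlots hw]
  -- a slot site that is a contact is an own slot
  have own_of_contact : ∀ {u}, u ∈ fccSlots → x + A u ∈ X → ⟪A u, n⟫_ℝ ≤ 0 := by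
    intro u hu huX
    rcases hcls _ huX (hslot1 hu) with ⟨w, hw, hle', hq⟩ | ⟨w, hw, hlt, hq⟩
    · have : A u = A w := by simpa using hq
      rw [this]; exact hle'
    · have hwn : ⟪A w, n⟫_ℝ = -Real.sqrt (2 / 3) := by
        rcases hmenu.2 w hw with h | h | h
        · rw [h] at hlt; exact absurd hlt (lt_irrefl 0)
        · rw [h] at hlt; exact absurd hlt (not_lt.2 s23.le)
        · exact h
      have : A u = A w - (2 * ⟪A w, n⟫_ℝ) • n := by simpa using hq
      exact absurd this (slot_ne_mirrorSite A hu hw hwn)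
  -- the predecessor is a contact, hence own: `⟪A δ₀, n⟫ ≥ 0`
  have hpredOwn : ⟪A (-δ₀), n⟫_ℝ ≤ 0 :=
    own_of_contact (neg_mem_fccSlots hδ₀) (by rw [map_neg, ← sub_eq_add_neg]; exact hpredX)
  have hge0 : 0 ≤ ⟪A δ₀, n⟫_ℝ := by rw [map_neg, inner_neg_left] at hpredOwn; linarith
  rcases hmenu.2 δ₀ hδ₀ with h0 | hpos | hneg
  · -- GLIDE-READ: the successor is an own slot, occupied
    exact Or.inl ⟨h0, hown δ₀ hδ₀ h0.le⟩
  · -- CROSS-READ: the successor site is a far slot; were it occupied it would be an own slot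
    refine Or.inr ⟨hpos, fun hsucc => ?_⟩
    have := own_of_contact hδ₀ hsucc
    rw [hpos] at this
    exact absurd this (not_le.2 s23)
  · rw [hneg] at hge0
    exact absurd hge0 (not_le.2 (by linarith))

/-! ## The first non-full ball of a launched line, and the injective windowed count -/

variable (X : Finset (EuclideanSpace ℝ (Fin 3))) (A : EuclideanSpace ℝ (Fin 3) ≃ₗᵢ[ℝ] EuclideanSpace ℝ (Fin 3))

/-- A slot image is nonzero. -/
theorem map_slot_ne_zero {δ₀ : EuclideanSpace ℝ (Fin 3)} (hδ₀ : δ₀ ∈ fccSlots) : A δ₀ ≠ 0 := by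
  rw [← norm_ne_zero_iff, LinearIsometryEquiv.norm_map, norm_eq_one_of_mem_fccSlots hδ₀]; norm_num

open scoped Classical in
/-- Along the line `b + (j+1) c` some ball is missing or not full (the chain is finite). -/
theorem exists_eventIndex {c : EuclideanSpace ℝ (Fin 3)} (hc : c ≠ 0) (b : EuclideanSpace ℝ (Fin 3)) :
    ∃ j : ℕ, b + ((j + 1 : ℕ) : ℝ) • c ∉ X ∨ ¬ IsFull X A (b + ((j + 1 : ℕ) : ℝ) • c) := by
  obtain ⟨m, hm⟩ := exists_succ_not_mem X hc b
  exact ⟨m, Or.inl hm⟩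

open scoped Classical in
/-- The number of FULL balls strictly between the launch ball and the event. -/
def chainEventSteps {c : EuclideanSpace ℝ (Fin 3)} (hc : c ≠ 0) (b : EuclideanSpace ℝ (Fin 3)) : ℕ :=
  Nat.find (exists_eventIndex X A hc b)

open scoped Classical in
/-- **THE EVENT of the line launched at `b`: the first ball `b + (j+1) c` that is missing or not full.** -/
def chainEvent {c : EuclideanSpace ℝ (Fin 3)} (hc : c ≠ 0) (b : EuclideanSpace ℝ (Fin 3)) : EuclideanSpace ℝ (Fin 3) :=
  b + ((chainEventSteps X A hc b + 1 : ℕ) : ℝ) • c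

open scoped Classical in
/-- The defining property of the event. -/
theorem chainEvent_spec {c : EuclideanSpace ℝ (Fin 3)} (hc : c ≠ 0) (b : EuclideanSpace ℝ (Fin 3)) :
    chainEvent X A hc b ∉ X ∨ ¬ IsFull X A (chainEvent X A hc b) :=
  Nat.find_spec (exists_eventIndex X A hc b)

open scoped Classical in
/-- Before the event every ball of the line is present and full. -/
theorem mem_and_isFull_of_lt_chainEventSteps {c : EuclideanSpace ℝ (Fin 3)} (hc : c ≠ 0) (b : EuclideanSpace ℝ (Fin 3))
    {j : ℕ} (hj : j < chainEventSteps X A hc b) :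
    b + ((j + 1 : ℕ) : ℝ) • c ∈ X ∧ IsFull X A (b + ((j + 1 : ℕ) : ℝ) • c) := by
  have h := Nat.find_min (exists_eventIndex X A hc b) hj
  push Not at h
  exact h

open scoped Classical in
/-- The predecessor of the event is `b + j c` with `j = chainEventSteps`. -/
theorem chainEvent_sub {c : EuclideanSpace ℝ (Fin 3)} (hc : c ≠ 0) (b : EuclideanSpace ℝ (Fin 3)) :
    chainEvent X A hc b - c = b + ((chainEventSteps X A hc b : ℕ) : ℝ) • c := by
  rw [chainEvent]; push_cast; rw [add_smul, one_smul]; abel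

open scoped Classical in
/-- **The predecessor of the event is present and full** (it is the launch ball, or a ball before the event), provided the launch ball is. -/
theorem chainEvent_pred_mem_isFull {c : EuclideanSpace ℝ (Fin 3)} (hc : c ≠ 0) {b : EuclideanSpace ℝ (Fin 3)} (hb : b ∈ X)
    (hfull : IsFull X A b) : chainEvent X A hc b - c ∈ X ∧ IsFull X A (chainEvent X A hc b - c) := by
  rw [chainEvent_sub]
  rcases Nat.eq_zero_or_pos (chainEventSteps X A hc b) with h0 | hpos
  · rw [h0]; simpa using And.intro hb hfull
  · obtain ⟨i, hi⟩ : ∃ i, chainEventSteps X A hc b = i + 1 := ⟨chainEventSteps X A hc b - 1, by omega⟩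
    have h := mem_and_isFull_of_lt_chainEventSteps X A hc b (j := i) (by omega)
    rw [hi]; exact h

open scoped Classical in
/-- **The event ball is present** when `c = A δ₀` is a slot of the frame and the launch ball is present and full: its full predecessor has the slot
site `+ A δ₀` occupied. -/
theorem chainEvent_mem {δ₀ : EuclideanSpace ℝ (Fin 3)} (hδ₀ : δ₀ ∈ fccSlots) {b : EuclideanSpace ℝ (Fin 3)} (hb : b ∈ X) (hfull : IsFull X A b) :
    chainEvent X A (map_slot_ne_zero A hδ₀) b ∈ X := by
  obtain ⟨-, hpf⟩ := chainEvent_pred_mem_isFull X A (map_slot_ne_zero A hδ₀) hb hfull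
  have := hpf δ₀ hδ₀
  rwa [sub_add_cancel] at this

open scoped Classical in
/-- **The event ball is not full.** -/
theorem not_isFull_chainEvent {δ₀ : EuclideanSpace ℝ (Fin 3)} (hδ₀ : δ₀ ∈ fccSlots) {b : EuclideanSpace ℝ (Fin 3)} (hb : b ∈ X)
    (hfull : IsFull X A b) : ¬ IsFull X A (chainEvent X A (map_slot_ne_zero A hδ₀) b) := by
  rcases chainEvent_spec X A (map_slot_ne_zero A hδ₀) b with h | h
  · exact absurd (chainEvent_mem X A hδ₀ hb hfull) h
  · exact h

open scoped Classical in
/-- **Distinct launch balls have distinct events** (no two launch balls on a common `c`-line). -/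
theorem chainEvent_injOn {c : EuclideanSpace ℝ (Fin 3)} (hc : c ≠ 0) {S : Finset (EuclideanSpace ℝ (Fin 3))} (hS : IsLaunchSet X c S) :
    Set.InjOn (chainEvent X A hc) ↑S := by
  intro b hb b' hb' h
  simp only [chainEvent] at h
  have e : b' = b + ((((chainEventSteps X A hc b + 1 : ℕ) : ℤ) - ((chainEventSteps X A hc b' + 1 : ℕ) : ℤ) : ℤ) : ℝ) • c := by
    push_cast
    rw [sub_smul]
    calc b' = (b' + ((chainEventSteps X A hc b' : ℝ) + 1) • c) - ((chainEventSteps X A hc b' : ℝ) + 1) • c := by simp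
      _ = (b + ((chainEventSteps X A hc b : ℝ) + 1) • c) - ((chainEventSteps X A hc b' : ℝ) + 1) • c := by
          have h' : b + ((chainEventSteps X A hc b : ℝ) + 1) • c = b' + ((chainEventSteps X A hc b' : ℝ) + 1) • c := by
            simpa using h
          rw [h']
      _ = b + (((chainEventSteps X A hc b : ℝ) + 1) • c - ((chainEventSteps X A hc b' : ℝ) + 1) • c) := by rw [add_sub_assoc]
  exact (hS.2.2 b (mem_coe.1 hb) b' (mem_coe.1 hb') _ e).symm

open scoped Classical in
/-- **THE INJECTIVE WINDOWED COUNT IN EVENT CURRENCY (guarded blocking).**  `c = A δ₀` a slot image with `0 ≤ c₂`; `S` a launch set for `c` whose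
balls are FULL and at heights `≥ zlo`; blocking above `zhi` assumed only on the guard `G` (19481-p1's `plate_blocks_of_not_slot`).  Then `#S` is at most
the number of balls `x ∈ X` that are NOT full, whose predecessor `x − c ∈ X` IS full, at height `≥ zlo`, and EITHER at height `≤ zhi + c₂` OR with the
predecessor outside the guard. -/
theorem card_le_card_chainEvents_guarded {δ₀ : EuclideanSpace ℝ (Fin 3)} (hδ₀ : δ₀ ∈ fccSlots) (hc2 : 0 ≤ (A δ₀) 2)
    {S : Finset (EuclideanSpace ℝ (Fin 3))} (hS : IsLaunchSet X (A δ₀) S) (hSfull : ∀ b ∈ S, IsFull X A b)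
    {zlo zhi : ℝ} (hzlo : ∀ b ∈ S, zlo ≤ b 2)
    (G : EuclideanSpace ℝ (Fin 3) → Prop) (hblock : ∀ e ∈ X, G e → zhi < e 2 → e + A δ₀ ∉ X) :
    S.card ≤ (X.filter fun x => ¬ IsFull X A x ∧ x - A δ₀ ∈ X ∧ IsFull X A (x - A δ₀) ∧ zlo ≤ x 2 ∧
      (x 2 ≤ zhi + (A δ₀) 2 ∨ ¬ G (x - A δ₀))).card := by
  set c := A δ₀ with hcdef
  have hc : c ≠ 0 := map_slot_ne_zero A hδ₀
  refine Finset.card_le_card_of_injOn (chainEvent X A hc) (fun b hb => ?_) (chainEvent_injOn X A hc hS)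
  have hbX : b ∈ X := hS.1 hb
  have hfull : IsFull X A b := hSfull b hb
  obtain ⟨hpX, hpF⟩ := chainEvent_pred_mem_isFull X A hc hbX hfull
  have hxX : chainEvent X A hc b ∈ X := chainEvent_mem X A hδ₀ hbX hfull
  refine mem_coe.2 (mem_filter.2 ⟨hxX, not_isFull_chainEvent X A hδ₀ hbX hfull, hpX, hpF, ?_, ?_⟩)
  · -- height ≥ zlo
    have : (chainEvent X A hc b) 2 = b 2 + ((chainEventSteps X A hc b : ℝ) + 1) * c 2 := by
      simp [chainEvent]
    rw [this]
    nlinarith [Nat.cast_nonneg (α := ℝ) (chainEventSteps X A hc b), hzlo b hb]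
  · by_cases hG : G (chainEvent X A hc b - c)
    · left
      have hle : (chainEvent X A hc b - c) 2 ≤ zhi := by
        by_contra hlt
        push Not at hlt
        have := hblock _ hpX hG hlt
        rw [sub_add_cancel] at this
        exact this hxX
      have e : (chainEvent X A hc b - c) 2 = (chainEvent X A hc b) 2 - c 2 := by simp
      linarith [e ▸ hle]
    · right; exact hG

open scoped Classical in
/-- **Unguarded form** (blocking everywhere above `zhi`): `#S ≤ #`events at heights in `[zlo, zhi + c₂]`. -/
theorem card_le_card_chainEvents {δ₀ : EuclideanSpace ℝ (Fin 3)} (hδ₀ : δ₀ ∈ fccSlots) (hc2 : 0 ≤ (A δ₀) 2)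
    {S : Finset (EuclideanSpace ℝ (Fin 3))} (hS : IsLaunchSet X (A δ₀) S) (hSfull : ∀ b ∈ S, IsFull X A b)
    {zlo zhi : ℝ} (hzlo : ∀ b ∈ S, zlo ≤ b 2) (hblock : ∀ e ∈ X, zhi < e 2 → e + A δ₀ ∉ X) :
    S.card ≤ (X.filter fun x => ¬ IsFull X A x ∧ x - A δ₀ ∈ X ∧ IsFull X A (x - A δ₀) ∧ zlo ≤ x 2 ∧ x 2 ≤ zhi + (A δ₀) 2).card := by
  set c := A δ₀ with hcdef
  have hc : c ≠ 0 := map_slot_ne_zero A hδ₀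
  refine Finset.card_le_card_of_injOn (chainEvent X A hc) (fun b hb => ?_) (chainEvent_injOn X A hc hS)
  have hbX : b ∈ X := hS.1 hb
  have hfull : IsFull X A b := hSfull b hb
  obtain ⟨hpX, hpF⟩ := chainEvent_pred_mem_isFull X A hc hbX hfull
  have hxX : chainEvent X A hc b ∈ X := chainEvent_mem X A hδ₀ hbX hfull
  refine mem_coe.2 (mem_filter.2 ⟨hxX, not_isFull_chainEvent X A hδ₀ hbX hfull, hpX, hpF, ?_, ?_⟩)
  · have : (chainEvent X A hc b) 2 = b 2 + ((chainEventSteps X A hc b : ℝ) + 1) * c 2 := by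
      simp [chainEvent]
    rw [this]
    nlinarith [Nat.cast_nonneg (α := ℝ) (chainEventSteps X A hc b), hzlo b hb]
  · have hle : (chainEvent X A hc b - c) 2 ≤ zhi := by
      by_contra hlt
      push Not at hlt
      have := hblock _ hpX hlt
      rw [sub_add_cancel] at this
      exact this hxX
    have e : (chainEvent X A hc b - c) 2 = (chainEvent X A hc b) 2 - c 2 := by simp
    linarith [e ▸ hle]

/-! ## Packaging: events pay or read, never twist -/

open scoped Classical in
/-- **Every event of the count PAYS or is a glide- or cross-READ** — the form the census's bookkeeping `sum_deficiency_ge_card_sub_card_reads`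
(…LevelLedgerDefs) consumes: the events with twelve contacts are twin readings of the frame along `A δ₀` in the sense of `chainEvent_trichotomy`. -/
theorem chainEvents_reads_are_twinReadings (hE1 : P5Exhaustion) (hX : ∀ p ∈ X, ∀ q ∈ X, p ≠ q → 1 ≤ dist p q)
    {δ₀ : EuclideanSpace ℝ (Fin 3)} (hδ₀ : δ₀ ∈ fccSlots) (W : EuclideanSpace ℝ (Fin 3) → Prop) :
    ∀ x ∈ (X.filter fun x => ¬ IsFull X A x ∧ x - A δ₀ ∈ X ∧ IsFull X A (x - A δ₀) ∧ W x),
      (X.filter fun q => dist x q = 1).card = 12 →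
        ∃ n : EuclideanSpace ℝ (Fin 3), IsMenuNormal A n ∧
          (∀ w ∈ fccSlots, ⟪A w, n⟫_ℝ ≤ 0 → x + A w ∈ X) ∧
          ((⟪A δ₀, n⟫_ℝ = 0 ∧ x + A δ₀ ∈ X) ∨ (⟪A δ₀, n⟫_ℝ = Real.sqrt (2 / 3) ∧ x + A δ₀ ∉ X)) := by
  intro x hx h12
  obtain ⟨-, hnot, hpX, hpF, -⟩ := mem_filter.1 hx
  rcases chainEvent_trichotomy hE1 A hX hδ₀ hpX hpF hnot with h | ⟨-, n, hmenu, hown, -, hcases⟩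
  · omega
  · exact ⟨n, hmenu, hown, hcases⟩

end Summit.Ventures.Crystal3D.Cruxes.TextureLiminf.TexShadow

end
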